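import Summits.ResolutionOfSingularities.ResolutionOfSingularities.Theorems.FrobeniusClosingSteerWords01Core
import Summits.ResolutionOfSingularities.ResolutionOfSingularities.Theorems.FrobeniusClosingSteerHullVocabulary

/-!
# Crux `Steer` (stmt-ResolutionOfSingularities-16345), line `switching-dichotomy` — WORDS 03: the core datum and the PHASE MACHINE of the
R1-odd residue (HOIST of the registered skeleton r31 727d9e199382098a, l.677–1012)

Holder res-L0-w41-lead-1 g4 on res-L0-w41-plan-1 RULING 47 (E1); see `…Words01Core` for the hoist protocol. The skeleton's r13 phase
machine byte for byte: `CoreDatum`, `IsMaxGenAt`, `CanStepAt`, `OrderOneGen`, `ExitAt`, `MultPAt`, `StallAt`, `MaxGenExists`, `GenExit`,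
`GenRebase`, `member_monotone`, `finset_subset_member_of_stronglySwitching`, `ContentInvertible`, `LogFinalAt`, `LogExitAt`, `LogExit`,
`LogFinalExitM`, `EternalStallPhaseSSL`, `EternalAlternationSSL`, `NonSwitchingCore`, `SeqLogFinalSS` and the two vacuity glue theorems.
Theses-free (imports `…Words01Core`, not `…Words02Stubs`, to stay out of the route file's rebuild cone — gate `lint.theses-cone`).
RULING 47b: `GenAt`, `ToroidalAt` are EXPORTED from res-type-028's landed hoist `…Theorems.SwitchingDichotomy.Hull` (p517308, verbatim the
same bodies), not re-declared. Nothing here is a statement of the manuscript [claim: Hironaka2017, status: under-review]. OURS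
(candidates / vocabulary; AI review is weaker than expert review).
-/

open Literature.AlgebraicGeometry.Resolution (IsAbhyankarPlace FGOver exists_ringKrullDim_eq_and_trdeg_eq
  trdeg_eq_trdeg_of_isFractionRing locAtCentre IsQuadraticTransformAlong SubringDominates IsRsopPart
  LocalUniformization3 RelLocalUniformization CossartPiltant2019General)
open Summit.ResolutionOfSingularities.ResolutionOfSingularities.Theorems.SteerRankThinness
  (HasProperCoarsening concl_of_hasProperCoarsening rankOne_of_not_hasProperCoarsening)

set_option linter.dupNamespace false

namespace Summit.ResolutionOfSingularities.ResolutionOfSingularities.Theorems.SwitchingDichotomy.Words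

export Summit.ResolutionOfSingularities.ResolutionOfSingularities.Theorems.SwitchingDichotomy.Hull (GenAt ToroidalAt)

/-! ## r13 — the PHASE MACHINE of the R1-odd residue (chain planner res-L0-w41-plan-1 g6's typed sub-plan
`L/w41/Sketch-R1-phases.lean` v3, sha16 c42bbe8866b20dc2, §3.3 / §3 / §3.1 / §5 / §6 copied VERBATIM except the
piece `Rebase`, which the holder replaces by the weaker `GenRebase` — see the r13 header) -/

/-! ### r13 §A — the core datum, bundled -/

/-- The hypotheses of `Sig.stub_steerDefectCore4` for one datum `(O, A₀, t)` at `(p, n)`, as ONE proposition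
(verbatim conjunction of the r10 binders from `A₀.FG` through `¬ (StronglySwitching ∧ ArchSeq ∧ ¬ Defect)`).
OURS. [folklore] -/
def CoreDatum (p n : ℕ) (k K : Type) [Field k] [Field K] [Algebra k K]
    (O : ValuationSubring K) (A₀ : Subalgebra k K) (h₀ : A₀.toSubring ≤ O.toSubring) (t : K) : Prop :=
  A₀.FG ∧ ∃ htp : t ^ p ∈ A₀, IsFractionRing (Algebra.adjoin k (insert t (A₀ : Set K))) K ∧
    IsRegularLocalRing (Localization.AtPrime
      (Ideal.comap (Subring.inclusion h₀) (IsLocalRing.maximalIdeal O))) ∧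
    (Ideal.comap (Subring.inclusion h₀) (IsLocalRing.maximalIdeal O)).IsMaximal ∧
    ZeroDim k O ∧
    ¬ ringKrullDim (Localization.AtPrime
      (Ideal.comap (Subring.inclusion h₀) (IsLocalRing.maximalIdeal O))) ≤ 2 ∧
    ¬ IsAbhyankarPlace O (algebraMap k K).fieldRange ⊤ ∧
    ¬ DenseAbhyankar k O ∧
    ¬ Discrete O ∧
    (∀ δ : Derivation ℤ (Localization.AtPrime (Ideal.comap (Subring.inclusion h₀)
        (IsLocalRing.maximalIdeal O))) (Localization.AtPrime (Ideal.comap (Subring.inclusion h₀)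
        (IsLocalRing.maximalIdeal O))),
      ¬ IsUnit (δ (algebraMap A₀.toSubring (Localization.AtPrime (Ideal.comap (Subring.inclusion h₀)
        (IsLocalRing.maximalIdeal O))) ⟨t ^ p, htp⟩))) ∧
    (∀ c : Localization.AtPrime (Ideal.comap (Subring.inclusion h₀) (IsLocalRing.maximalIdeal O)),
      algebraMap A₀.toSubring (Localization.AtPrime (Ideal.comap (Subring.inclusion h₀)
        (IsLocalRing.maximalIdeal O))) ⟨t ^ p, htp⟩ ≠ c ^ p) ∧
    Algebra.trdeg k K = (n : Cardinal) ∧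
    ¬ (StronglySwitching O A₀ ∧ ArchSeq O A₀ ∧ ¬ Defect O A₀ t p)

/-! ### r13 §B — phases of the point sequence: re-cleaned generators at every member (sub-plan §3 verbatim) -/

section Phases

variable {K : Type} [Field K]

/-- MAXIMAL generator: every generator `s''` above `s'` (`s' ∈ S[s'']`) is already in `S[s']` — the simple order
`S[s']` is maximal among the `S[s'']`, `s'' ^ p ∈ S` (these are submodules of the integral closure of `S` in `K`,
a finite `S`-module for `S` excellent: maximal ones exist, `MaxGenExists`). Kills FAKE multiplicity: `x · s` is a
generator whenever `s` is, can always take a strict-transform step (`x · s = x · s + 0`), and is never maximal.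
OURS. [folklore] -/
def IsMaxGenAt (S : Subring K) (p : ℕ) (t s' : K) : Prop :=
  GenAt S p t s' ∧ ∀ s'' : K, s'' ^ p ∈ S → s' ∈ Subring.closure (insert s'' (S : Set K)) →
    s'' ∈ Subring.closure (insert s' (S : Set K))

/-- The generator `s'` CAN STEP at `S`: a strict-transform step `s' = x * s'' + g` (`x` an exceptional parameter of
`S` along `O`, `g ∈ S`) lands with `s'' ^ p` in SOME quadratic transform `S₁` of `S` along `O` — for `S` regular,
the cleaned radicand `s' ^ p - g ^ p` has order `≥ p` (`x ^ p S₁ ∩ S = 𝔪_S ^ p`); the typed `MultP` read through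
the dictionary. Stated over SOME `S₁` so that no uniqueness of quadratic transforms is needed. OURS. [folklore] -/
def CanStepAt (O : ValuationSubring K) (S : Subring K) (p : ℕ) (s' : K) : Prop :=
  ∃ (S₁ : Subring K) (s'' : K), IsQuadraticTransformAlong O S S₁ ∧ IsStrictStep O S s' s'' ∧ s'' ^ p ∈ S₁

/-- ORDER-ONE FORM of the generator `s'` over `S`: after cleaning, `s' ^ p - g ^ p` is a regular parameter of `S`
(so `S[s']` is regular local over the centre; shape of r8's `OrderOneAt` at a single member).
[cite: HeinzerEtAl2015, Prop. 4.4] [folklore] -/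
def OrderOneGen (S : Subring K) (p : ℕ) (s' : K) : Prop :=
  ∃ g ∈ S, ∃ (_ : IsLocalRing S) (z : Fin 1 → S), IsRsopPart z ∧ ((z 0 : S) : K) = s' ^ p - g ^ p

/-- EXIT STAGE: some generator of the torsor over `S` is in order-one form. OURS. [folklore] -/
def ExitAt (S : Subring K) (p : ℕ) (t : K) : Prop :=
  ∃ s' : K, GenAt S p t s' ∧ OrderOneGen S p s'

/-- MULTIPLICITY-`p` (RE-ENTRY) STAGE: some MAXIMAL generator can take a strict-transform step. OURS. [folklore] -/
def MultPAt (O : ValuationSubring K) (S : Subring K) (p : ℕ) (t : K) : Prop :=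
  ∃ s' : K, IsMaxGenAt S p t s' ∧ CanStepAt O S p s'

/-- STALL STAGE: a maximal generator exists, no generator exits, no maximal generator steps (every maximal
generator has cleaned order in `[2, p - 1]` when the residue field is perfect). OURS. [folklore] -/
def StallAt (O : ValuationSubring K) (S : Subring K) (p : ℕ) (t : K) : Prop :=
  (∃ s' : K, IsMaxGenAt S p t s') ∧ ¬ ExitAt S p t ∧ ¬ MultPAt O S p t

end Phases

/-! ### r13 §C — the pieces (each a `Prop`; class and owner in the docstring; sub-plan §3.1 / §6 verbatim except
`GenRebase`) -/

/-- **P0 · MaxGenExists** (DISCHARGEABLE, M–L — commutative algebra; REGISTERED STUB r13, `stub_maxGenExists`): over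
every member `R M` of the point sequence of a core datum a MAXIMAL generator exists. Plan: `t` itself is a generator
(`t ^ p ∈ A₀ ⊆ R M`); the orders `R M [s'']` are `R M`-submodules of the integral closure of `R M` in `K`, which is a
FINITE `R M`-module (`R M` is a localisation of a finitely generated `k`-domain `A₁` with `[K : Frac A₁] = p`, tree
`Literature.….NoetherFiniteIntegralClosure_holds` + localisation), so a maximal one above `R M [t]` exists (ACC).
Why it might fail: only as a formalization cost. (ref. Matsumura1987, §32) (folklore) -/
def MaxGenExists : Prop :=
  ∀ p : ℕ, p.Prime → ∀ n : ℕ, 4 ≤ n →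
    ∀ (k K : Type) [Field k] [CharP k p] [PerfectField k] [Field K] [Algebra k K]
    (O : ValuationSubring K) (A₀ : Subalgebra k K) (h₀ : A₀.toSubring ≤ O.toSubring) (t : K),
    CoreDatum p n k K O A₀ h₀ t →
    ∀ R : ℕ → Subring K, R 0 = locAtCentre A₀.toSubring O →
      (∀ i, IsQuadraticTransformAlong O (R i) (R (i + 1))) →
      ∀ M : ℕ, ∃ s' : K, IsMaxGenAt (R M) p t s'

/-- **P1 · GenExit** (DISCHARGED r13 by `Theorems.SwitchingDichotomy.genExit`, lead res-L0-w41-lead-1 g3,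
`Theorems/FrobeniusClosingSteerCore4GenExit.lean`): an exit stage gives `Concl` — re-base at the exiting generator
(`GenRebase`), the LANDED `orderOneExit` (res-L0-w41-stub-3, p479657) at `N = 0` along `i ↦ R (M + i)`, push down.
OURS. (ref. HeinzerEtAl2015, Prop. 4.4) (folklore) -/
def GenExit : Prop :=
  ∀ p : ℕ, p.Prime → ∀ n : ℕ, 4 ≤ n →
    ∀ (k K : Type) [Field k] [CharP k p] [PerfectField k] [Field K] [Algebra k K]
    (O : ValuationSubring K) (A₀ : Subalgebra k K) (h₀ : A₀.toSubring ≤ O.toSubring) (t : K),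
    CoreDatum p n k K O A₀ h₀ t →
    ∀ R : ℕ → Subring K, R 0 = locAtCentre A₀.toSubring O →
      (∀ i, IsQuadraticTransformAlong O (R i) (R (i + 1))) →
      ∀ M : ℕ, ExitAt (R M) p t → Concl O A₀ t

/-- **P2⁰ · GenRebase** (r13, the holder's replacement of the sub-plan's `Rebase`; DISCHARGED by
`Theorems.SwitchingDichotomy.genRebase`, lead res-L0-w41-lead-1 g3, `Theorems/FrobeniusClosingSteerCore4GenExit.lean`):
EVERY generator `s'` over EVERY member `R M` re-bases the datum — a finitely generated `A' ⊇ A₀` inside `O` with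
`locAtCentre A' O = R M`, `s' ^ p ∈ A'`, `t ∈ A'[s']`, `Frac (A'[s']) = K`, regular at the centre, and
`Concl O A' s' → Concl O A₀ t`. No step hypothesis on `s'` and no transfer of the other core binders: the
composition (`concl_of_phasesSSL`) recovers `CoreDatum p n k K O A' h' s'` OR `Concl O A' s'` outright from the
LANDED range cascade of `Steer_of` (`concl_or_coreDatum`), so the sub-plan's `CanStepAt ⇒ hδ / hc` transfer is not
needed anywhere. (ref. NovacoskiSpivakovsky2014, Lemma 2.5) (ref. Abhyankar1956Valuations, Prop. 8) (folklore) -/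
def GenRebase : Prop :=
  ∀ (p : ℕ) (k K : Type) [Field k] [Field K] [Algebra k K]
    (O : ValuationSubring K) (A₀ : Subalgebra k K) (h₀ : A₀.toSubring ≤ O.toSubring) (t : K),
    A₀.FG → t ^ p ∈ A₀ → IsFractionRing (Algebra.adjoin k (insert t (A₀ : Set K))) K →
    IsRegularLocalRing (Localization.AtPrime
      (Ideal.comap (Subring.inclusion h₀) (IsLocalRing.maximalIdeal O))) →
    ∀ R : ℕ → Subring K, R 0 = locAtCentre A₀.toSubring O →
      (∀ i, IsQuadraticTransformAlong O (R i) (R (i + 1))) →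
      ∀ (M : ℕ) (s' : K), s' ^ p ∈ R M → t ∈ Subring.closure (insert s' (R M : Set K)) →
        ∃ (A' : Subalgebra k K) (h' : A'.toSubring ≤ O.toSubring), A₀ ≤ A' ∧
          locAtCentre A'.toSubring O = R M ∧ A'.FG ∧ s' ^ p ∈ A' ∧
          t ∈ Algebra.adjoin k (insert s' (A' : Set K)) ∧
          IsFractionRing (Algebra.adjoin k (insert s' (A' : Set K))) K ∧
          IsRegularLocalRing (Localization.AtPrime
            (Ideal.comap (Subring.inclusion h') (IsLocalRing.maximalIdeal O))) ∧
          (Concl O A' s' → Concl O A₀ t)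

/-! ### r13 §D — the SS cut (sub-plan §5 verbatim): under `StronglySwitching` the point sequence is cofinal among
the models inside `O ∩ Frac A₀` (idea-2 g3's `W_far` — `¬ StronglySwitching`, `ArchSeq`, rank one — inhabits the
hypotheses of the unrestricted alternation phase and is EASY, so the frontier residuals carry `StronglySwitching`
and the complement is the separate piece `NonSwitchingCore`) -/

section SSCut

variable {k K : Type} [Field k] [Field K] [Algebra k K]

/-- Members of a quadratic sequence along `O` increase. [cite: NovacoskiSpivakovsky2014, Def. 2.11] -/
theorem member_monotone (O : ValuationSubring K) (R : ℕ → Subring K)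
    (hRq : ∀ i, IsQuadraticTransformAlong O (R i) (R (i + 1))) : Monotone R :=
  monotone_nat_of_le_succ fun i => by
    obtain ⟨_, h⟩ := hRq i
    exact (Literature.AlgebraicGeometry.Resolution.IsLocalBlowupAlong.isLocalBlowup h).le

/-- **Cofinality under strong switching**: finitely many elements of `O ∩ Frac A₀` lie in a common member of the
point sequence; hence every finitely generated model `A₁ ⊆ O ∩ Frac A₀` does (apply to a generating finset), and
`locAtCentre A₁ O ≤ R M` follows by domination. Pure logic from the definition. OURS.
[cite: HeinzerEtAl2015, Discussion 4.2] -/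
theorem finset_subset_member_of_stronglySwitching (O : ValuationSubring K) (A₀ : Subalgebra k K)
    (hss : StronglySwitching O A₀) (R : ℕ → Subring K) (hR0 : R 0 = locAtCentre A₀.toSubring O)
    (hRq : ∀ i, IsQuadraticTransformAlong O (R i) (R (i + 1))) (F : Finset K)
    (hO : ∀ x ∈ F, x ∈ O) (hfr : ∀ x ∈ F, IsFracOf A₀ x) : ∃ M, (↑F : Set K) ⊆ R M := by
  classical
  have hmono := member_monotone O R hRq
  induction F using Finset.induction_on with
  | empty => exact ⟨0, by simp⟩
  | insert a F ha ih =>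
    obtain ⟨M₁, hM₁⟩ := ih (fun x hx => hO x (Finset.mem_insert_of_mem hx))
      (fun x hx => hfr x (Finset.mem_insert_of_mem hx))
    obtain ⟨i, hi⟩ := hss R hR0 hRq a (hO a (Finset.mem_insert_self a F)) (hfr a (Finset.mem_insert_self a F))
    refine ⟨max M₁ i, ?_⟩
    intro x hx
    rw [Finset.coe_insert, Set.mem_insert_iff] at hx
    rcases hx with rfl | hx
    · exact hmono (le_max_right M₁ i) hi
    · exact hmono (le_max_left M₁ i) (hM₁ hx)

end SSCut

/-! ### r13 §E — log-final exits (sub-plan §6 = res-L0-w41-idea-2 g3's E1/E2 vocabulary `Sketch-idea-2c.lean`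
bc010f70dd4ddc0c, verbatim): a member that is LOG-FINAL for `t` (content of `d(t ^ p)` invertible — E1, exit by the
named fact F-E1 `Literature.RingTheory.Derivation.Posva2023_Lemma_2_37_rank1` p491440 — or an exchanged radicand
toroidal with an exponent prime to `p` — E2, exit by `radicandExchange` p483824 + `stub_switchingExit`) is an exit the
order-one test `ExitAt` does not see; the frontier residuals carry «no member is ever log-final» -/

section LogFinal

variable {k K : Type} [Field k] [Field K] [Algebra k K]

/-- idea-2 verbatim: the Jacobian content ideal of `f ∈ S` is invertible and attained. OURS. [folklore] -/
def ContentInvertible (S : Subring K) (f : S) : Prop :=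
  ∃ h : S, h ≠ 0 ∧ (∀ δ : Derivation ℤ S S, h ∣ δ f) ∧
    ∃ (δ : Derivation ℤ S S) (u : S), IsUnit u ∧ δ f = h * u

/-- idea-2 verbatim: LOG-FINAL presentation at `S` for `K = (Frac A₀)(t)`: E1 (content of `t ^ p` invertible) or
E2 (an exchanged radicand `t₂ ^ p`, `t₂ ∉ Frac A₀`, toroidal with an exponent prime to `p`). OURS.
[cite: Posva2023, Lemma 9] [folklore] -/
def LogFinalAt (p : ℕ) (S : Subring K) [IsLocalRing S] (A₀ : Subalgebra k K) (t : K) : Prop :=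
  (∃ f' : S, (f' : K) = t ^ p ∧ ContentInvertible S f') ∨
    (∃ t₂ : K, ¬ IsFracOf A₀ t₂ ∧ ToroidalAt p S (t₂ ^ p))

/-- Instance-free wrapper: the member `S` is local and log-final for `t`. OURS. [folklore] -/
def LogExitAt (S : Subring K) (p : ℕ) (A₀ : Subalgebra k K) (t : K) : Prop :=
  ∃ (_ : IsLocalRing S), LogFinalAt p S A₀ t

end LogFinal

/-- **P1ᴸ · LogExit** (DISCHARGEABLE, size M; REGISTERED STUB r13, `stub_logExit`; CHAIN v5.3 row res-L0-w41-stub-9):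
a log-final member of the point sequence gives `Concl` — every member `R M` is the centre ring of a finitely
generated model (`GenRebase` with `s' := t`), then idea-2's `LogFinalExitM` (E1 via F-E1 p491440 and their glue
`SandwichExit_of_FE1`; E2 via `radicandExchange` p483824 + degree-`p` transfer + `stub_switchingExit`). OURS.
(ref. Posva2023, Lemma 9) (folklore) -/
def LogExit : Prop :=
  ∀ p : ℕ, p.Prime → ∀ n : ℕ, 4 ≤ n →
    ∀ (k K : Type) [Field k] [CharP k p] [PerfectField k] [Field K] [Algebra k K]
    (O : ValuationSubring K) (A₀ : Subalgebra k K) (h₀ : A₀.toSubring ≤ O.toSubring) (t : K),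
    CoreDatum p n k K O A₀ h₀ t →
    ∀ R : ℕ → Subring K, R 0 = locAtCentre A₀.toSubring O →
      (∀ i, IsQuadraticTransformAlong O (R i) (R (i + 1))) →
      ∀ M : ℕ, LogExitAt (R M) p A₀ t → Concl O A₀ t

/-- **L · LogFinalExitM** — res-L0-w41-idea-2 g3's MODEL FORM of the two log-final exits, VERBATIM
(`L/res-L0-w41-idea-2/Sketch-idea-2c.lean` v3 sha16 1866cc8b286caf08, `Idea2g3.LogFinalExitM`; REGISTERED STUB r16,
`stub_logFinalExitM` — it is the statement res-L0-w41-stub-9 (E1: commuting `p`-nilpotent frame, `n − 1` iterations of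
the named fact F-E1 `Posva2023_Lemma_2_37_rank1` p491440, Frobenius sandwich, finite integral closure), res-L0-w41-stub-6
(degree-`p` transfer `DegreePTransfer`, p497399, for E2 with `radicandExchange` p483824 + `stub_switchingExit`) and
res-L0-w41-stub-5 (`[F : F^p] = p^n`) are proving, per idea-2's `PLAN-LogFinalExitM.md`): a log-final presentation of
`d(t ^ p)` on a finitely generated regular model `A₁` of `Frac A₀`, `A₀ ≤ A₁ ⊆ O`, gives `Concl`. The member form `LogExit`
is DERIVED from it in this skeleton (`stub_logExit`, via `GenRebase` at `s' := t`). r18: ONE binder added at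
res-L0-w41-stub-9's request (04:58:27Z) — `ZeroDim k O` after `A₁.toSubring ≤ O.toSubring` (closed centre: the residue
field of `locAtCentre A₁ O` is algebraic over the perfect `k`, hence perfect, so Kunz's `p`-basis LIB-03 applies);
composition-neutral (every consumer runs under `CoreDatum`, whose 5th conjunct it is). OURS. [cite: Posva2023, Lemma 9]
[folklore] -/
def LogFinalExitM (p : ℕ) : Prop :=
  ∀ (k K : Type) [Field k] [CharP k p] [PerfectField k] [Field K] [Algebra k K]
    (O : ValuationSubring K) (A₀ A₁ : Subalgebra k K) (h₀ : A₀.toSubring ≤ O.toSubring) (t : K),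
    p.Prime → A₀.FG → t ^ p ∈ A₀ → IsFractionRing (Algebra.adjoin k (insert t (A₀ : Set K))) K →
    IsRegularLocalRing
      (Localization.AtPrime (Ideal.comap (Subring.inclusion h₀) (IsLocalRing.maximalIdeal O))) →
    A₀ ≤ A₁ → A₁.FG → (∀ x ∈ A₁, IsFracOf A₀ x) → A₁.toSubring ≤ O.toSubring → ZeroDim k O →
    ∀ (_ : IsLocalRing (locAtCentre A₁.toSubring O)),
      IsRegularLocalRing (locAtCentre A₁.toSubring O) → LogFinalAt p (locAtCentre A₁.toSubring O) A₀ t →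
      Concl O A₀ t

/-- **Φ3ᴸˢ · EternalStallPhaseSSL** (FRONTIER residual; REGISTERED STUB r13, `stub_eternalStallPhaseSSL`; the home of
res-L0-w41-idea-2's line `foliation-log-final-exit` restricted to stall phases and of `res-L0-w41-strat-1`): a
STRONGLY SWITCHING core datum at odd `p` whose point sequence has a QUIET TAIL — from some stage on every stage is a
stall (a maximal generator exists, no generator is in order-one form, no maximal generator can step: cleaned orders in
`[2, p - 1]` for ever) — and NO member of which is ever log-final, is locally uniformizable. This is
`Literature.Barriers.ResolutionOfSingularities.DimensionFourFrontier` verbatim (LU of a multiplicity-`ν` purely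
inseparable hypersurface, `2 ≤ ν < p`, along a zero-dimensional valuation, ambient dimension `≥ 5`) WITH the extra
information «eternal stall, strongly switching (hence, by the core binder, defect or not parameter-archimedean), never
log-final». No inhabitant is on record (idea-2's `W_far` and tri-2's re-entry datum are NOT strongly switching). Why
it might fail: no invariant is known to improve for multiplicity-`< p` purely inseparable hypersurfaces in ambient
dimension `≥ 5` in characteristic `p`; this may be exactly where the defect lives. (ref. CossartPiltant2019, Rem. 3.2)
(ref. CutkoskyMourtada2019, Thm. 7.1) (ref. HeinzerEtAl2015, Discussion 4.2) OURS. -/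
def EternalStallPhaseSSL : Prop :=
  ∀ p : ℕ, p.Prime → p ≠ 2 → ∀ n : ℕ, 4 ≤ n → TorsorLUZeroDimBelow p n →
    ∀ (k K : Type) [Field k] [CharP k p] [PerfectField k] [Field K] [Algebra k K]
    (O : ValuationSubring K) (A₀ : Subalgebra k K) (h₀ : A₀.toSubring ≤ O.toSubring) (t : K),
    CoreDatum p n k K O A₀ h₀ t → StronglySwitching O A₀ → (n = 4 → ¬ HasProperCoarsening O) →
    ∀ R : ℕ → Subring K, R 0 = locAtCentre A₀.toSubring O →
      (∀ i, IsQuadraticTransformAlong O (R i) (R (i + 1))) →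
      (∀ M, ¬ LogExitAt (R M) p A₀ t) →
      (∃ M₀ : ℕ, ∀ M, M₀ ≤ M → StallAt O (R M) p t) → Concl O A₀ t

/-- **Φ4ᴸˢ · EternalAlternationSSL** (FRONTIER residual; REGISTERED STUB r13, `stub_eternalAlternationSSL`; tri-2's open
object, chain tests K4.1e / K4.1f): a STRONGLY SWITCHING core datum at odd `p` whose point sequence NEVER reaches an
exit stage, has INFINITELY MANY multiplicity-`p` re-entry stages, admits from NO generator at NO stage an eternal affine
torsor run along ANY quadratic sequence from that stage (every re-entry's run dies in a stall), and NO member of which is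
ever log-final — is locally uniformizable. No inhabitant is on record (the alternating data known — tri-2's RE-ENTRY
datum `p = 3`, `n = 4`, `f = y₂² + y₃y₄ + y₁³ + y₁²y₂ + y₁⁴`, and idea-2's `W_far` — are absorbing, i.e. not strongly
switching, and belong to `NonSwitchingCore`). No termination invariant spanning re-entries is on record (`χ ≤ ν < p` is
FALSE across a re-entry, tri-2 T2). Why it might fail: this may be where the defect of rank-one non-Abhyankar valuations
in dimension `≥ 4` lives. (ref. HeinzerEtAl2015, Discussion 4.2) (ref. Kuhlmann2010ArtinSchreier, §2)
(ref. CutkoskyMourtada2019, Thm. 7.1) OURS. -/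
def EternalAlternationSSL : Prop :=
  ∀ p : ℕ, p.Prime → p ≠ 2 → ∀ n : ℕ, 4 ≤ n → TorsorLUZeroDimBelow p n →
    ∀ (k K : Type) [Field k] [CharP k p] [PerfectField k] [Field K] [Algebra k K]
    (O : ValuationSubring K) (A₀ : Subalgebra k K) (h₀ : A₀.toSubring ≤ O.toSubring) (t : K),
    CoreDatum p n k K O A₀ h₀ t → StronglySwitching O A₀ → (n = 4 → ¬ HasProperCoarsening O) →
    ∀ R : ℕ → Subring K, R 0 = locAtCentre A₀.toSubring O →
      (∀ i, IsQuadraticTransformAlong O (R i) (R (i + 1))) →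
      (∀ M, ¬ LogExitAt (R M) p A₀ t) →
      (∀ M, ¬ ExitAt (R M) p t) →
      (∀ M₀ : ℕ, ∃ M, M₀ ≤ M ∧ MultPAt O (R M) p t) →
      (∀ (M : ℕ) (s' : K) (R' : ℕ → Subring K) (u : ℕ → K), GenAt (R M) p t s' →
        R' 0 = R M → (∀ i, IsQuadraticTransformAlong O (R' i) (R' (i + 1))) →
        ¬ IsTorsorRun O R' s' p u) →
      Concl O A₀ t

/-- **NonSwitchingCore** (FRONTIER as a whole; REGISTERED STUB r13, `stub_nonSwitchingCore`; the `¬ StronglySwitching`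
part of the R1-odd core at odd `p` — `W_far`'s home): the point sequence is not cofinal, centres of positive dimension
are needed. PLAN of record (CHAIN v5.2 §A1 (β)/(γ)): on its rank-one (`ArchSeq`) part idea-2's model-free
`FoliationLUR1M` (costume split F-LU + DICT owed, tri-1) + `LogFinalExitM`; its rank `≥ 2` part at `n = 4` is a FACT
DEBT via res-L0-w41-idea-1's landed `concl_of_hasProperCoarsening` (p493179, ⇐ `CossartPiltant2019General`); `n ≥ 5`,
rank `≥ 2` is not covered by the `Below` antecedent (typed gap, recorded). (ref. HeinzerEtAl2015, Discussion 4.2)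
(ref. CossartPiltant2019, Thm. 1.1) OURS. -/
def NonSwitchingCore : Prop :=
  ∀ p : ℕ, p.Prime → p ≠ 2 → ∀ n : ℕ, 4 ≤ n → TorsorLUZeroDimBelow p n →
    ∀ (k K : Type) [Field k] [CharP k p] [PerfectField k] [Field K] [Algebra k K]
    (O : ValuationSubring K) (A₀ : Subalgebra k K) (h₀ : A₀.toSubring ≤ O.toSubring) (t : K),
    CoreDatum p n k K O A₀ h₀ t → (n = 4 → ¬ HasProperCoarsening O) → ¬ StronglySwitching O A₀ → Concl O A₀ t

/-- **idea-2's sequence form under strong switching** (their `FoliationLUR1S`, compact shape; FRONTIER, unrefuted, NOT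
registered: the strong form of the (α) heart — it makes both Φ3ᴸˢ and Φ4ᴸˢ hold vacuously, `…_of_seqLogFinalSS`): a
strongly switching core datum at odd `p` has a LOG-FINAL member. (ref. Posva2023, Lemma 9) OURS. -/
def SeqLogFinalSS : Prop :=
  ∀ p : ℕ, p.Prime → p ≠ 2 → ∀ n : ℕ, 4 ≤ n → TorsorLUZeroDimBelow p n →
    ∀ (k K : Type) [Field k] [CharP k p] [PerfectField k] [Field K] [Algebra k K]
    (O : ValuationSubring K) (A₀ : Subalgebra k K) (h₀ : A₀.toSubring ≤ O.toSubring) (t : K),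
    CoreDatum p n k K O A₀ h₀ t → StronglySwitching O A₀ → (n = 4 → ¬ HasProperCoarsening O) →
    ∀ R : ℕ → Subring K, R 0 = locAtCentre A₀.toSubring O →
      (∀ i, IsQuadraticTransformAlong O (R i) (R (i + 1))) →
      ∃ M, LogExitAt (R M) p A₀ t

/-- idea-2's sequence form makes the quiet-tail residual hold VACUOUSLY. Pure logic. OURS. [folklore] -/
theorem eternalStallPhaseSSL_of_seqLogFinalSS (h : SeqLogFinalSS) : EternalStallPhaseSSL := by
  intro p hp hp2 n hn hB k K _ _ _ _ _ O A₀ h₀ t core hss hnc R hR0 hRq hnl _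
  obtain ⟨M, hM⟩ := h p hp hp2 n hn hB k K O A₀ h₀ t core hss hnc R hR0 hRq
  exact absurd hM (hnl M)

/-- idea-2's sequence form makes the alternation residual hold VACUOUSLY. Pure logic. OURS. [folklore] -/
theorem eternalAlternationSSL_of_seqLogFinalSS (h : SeqLogFinalSS) : EternalAlternationSSL := by
  intro p hp hp2 n hn hB k K _ _ _ _ _ O A₀ h₀ t core hss hnc R hR0 hRq hnl _ _ _
  obtain ⟨M, hM⟩ := h p hp hp2 n hn hB k K O A₀ h₀ t core hss hnc R hR0 hRq
  exact absurd hM (hnl M)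


end Summit.ResolutionOfSingularities.ResolutionOfSingularities.Theorems.SwitchingDichotomy.Words
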